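import Summits.SmoothPoincare4.SmoothPoincare4.Theorems.DottedCircleRasmussenDcrGapHelperHandlebodyChartModelHandlesCoverAux
import Summits.SmoothPoincare4.SmoothPoincare4.Theorems.DottedCircleRasmussenDcrGapHelperHandlebodyChartModelHandlesCover

/-!
# Helper `helper_handlebodyChart_modelHandles` (M3: handle structure of the model dotted handlebody `D_k`)
# of line `mk_friends` for crux `DcrGap` — handle charts, part 11: the cover of the arch by one chart
(item stmt-SmoothPoincare4-16128, route route-SmoothPoincare4-DottedCircleRasmussen)

Towards the registered stub `helper_handlebodyChart_modelHandles_data_part1`: its cover clause `A_j ⊆ h_j(T)` for one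
chart (`ModelHandles.chart_cover`).  Proof by continuation (`ModelHandles.subset_image_of_open_at`): on the compact
parameter box `K = {|p₀| ≤ 201/200, |p₁| ≤ 9/10, p₂² + p₃² ≤ 1} ⊆ W` the chart is continuous and open at the interior
parameters (hypotheses, from smoothness and immersivity); the arch `A_j` is the image of
(frame arch) × (disc `|w| ≤ 1/(2000(k+1))`) under `(f, w) ↦ (z₀ + f u, w)`, hence preconnected
(`ModelHandles.isPathConnected_archFrame`); a parameter of `K` mapped into `A_j` is interior
(`ModelHandles.chart_arch_avoid`) and the parameter `(0, 3/20, 0, 0)` is mapped into `A_j`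
(`ModelHandles.chart_base_point`); finally interior parameters mapped into the arch lie in `T`.

Registered summary `helper_handlebodyChart_modelHandles_chartCover`.  No definitions, no named facts, no `sorry`.
References: R. Kirby, *The Topology of 4-Manifolds*, LNM 1374 (1989), Ch. I §2 [Kirby1989].
-/

-- the prescribed namespace `Summit.<P>.<Sub>.…` duplicates `SmoothPoincare4` (P = Sub)
set_option linter.dupNamespace false
set_option linter.style.longLine false
noncomputable section

open scoped Manifold ContDiff Topology ComplexConjugate
open Function Set Metric Filter
open Literature.Topology.FourManifolds Literature.Topology.FourManifolds.MMSW
open Literature.AlgebraicTopology.Homotopy.HopfFibration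

namespace Summit.SmoothPoincare4.SmoothPoincare4.Theorems.DcrGap.MkFriends

namespace ModelHandles

/-- **The compact parameter box `K = {|p₀| ≤ 201/200, |p₁| ≤ 9/10, p₂² + p₃² ≤ 1}` and its interior.**
[folklore] -/
theorem coverBox_props :
    IsCompact {p : EuclideanSpace ℝ (Fin 4) | |p 0| ≤ 201 / 200 ∧ |p 1| ≤ 9 / 10 ∧ (p 2) ^ 2 + (p 3) ^ 2 ≤ 1} ∧
    IsOpen {p : EuclideanSpace ℝ (Fin 4) | |p 0| < 201 / 200 ∧ |p 1| < 9 / 10 ∧ (p 2) ^ 2 + (p 3) ^ 2 < 1} := by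
  constructor
  · refine Metric.isCompact_of_isClosed_isBounded ?_ ?_
    · simp only [Set.setOf_and]
      exact (isClosed_le (by fun_prop) continuous_const).inter
        ((isClosed_le (by fun_prop) continuous_const).inter (isClosed_le (by fun_prop) continuous_const))
    · refine (isBounded_closedBall (x := (0 : EuclideanSpace ℝ (Fin 4))) (r := 3)).subset fun p hp => ?_
      rw [mem_closedBall_zero_iff]
      obtain ⟨h0, h1, h23⟩ := hp
      have hsq : ‖p‖ ^ 2 = (p 0) ^ 2 + (p 1) ^ 2 + (p 2) ^ 2 + (p 3) ^ 2 := by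
        rw [EuclideanSpace.norm_eq, Real.sq_sqrt (Finset.sum_nonneg fun i _ => by positivity), Fin.sum_univ_four]
        simp [sq_abs]
      have hp0 : (p 0) ^ 2 ≤ 2 := by nlinarith [abs_nonneg (p 0), sq_abs (p 0)]
      have hp1 : (p 1) ^ 2 ≤ 1 := by nlinarith [abs_nonneg (p 1), sq_abs (p 1)]
      nlinarith [norm_nonneg p]
  · simp only [Set.setOf_and]
    exact (isOpen_lt (by fun_prop) continuous_const).inter
      ((isOpen_lt (by fun_prop) continuous_const).inter (isOpen_lt (by fun_prop) continuous_const))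

/-- **The cover of the arch by one chart**: every point `y` of the arch `A_j` (`|w(y)| ≤ 1/(2000(k+1))`, and
`q = z(y) - z₀` in the cap or in a leg wedge relative to `v = c_j - z₀`) is `h p` for some `p` in the closed tube
`T`, provided `h` is continuous on `W` and open at its points. [folklore] -/
theorem chart_cover {k : ℕ} {j : Fin k} {R S b : ℝ → ℝ} {fr fm : ℝ → ℝ → ℝ} {v : ℂ} {N : ℝ} {e : ℝ → ℂ}
    {h : EuclideanSpace ℝ (Fin 4) → EuclideanSpace ℝ (Fin 4)} {W : Set (EuclideanSpace ℝ (Fin 4))}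
    (hv : v = holeCentre k j - Complex.mk 0 (-(20 * (k : ℝ))))
    (hReven : ∀ t, R (-t) = R t) (hSsymm : ∀ t, S (-t) = 1 - S t) (hRout : ∀ t, 1 / 2 ≤ |t| → R t = 2 / 15 * (2 - |t|))
    (hRbend : ∀ t, |t| ≤ 1 / 5 → ‖v‖ - 1 / 250 ≤ R t ∧ R t ≤ ‖v‖)
    (hRbounds : ∀ t, -2 ≤ t → t ≤ 0 → 2 / 15 * (2 + t) ≤ R t ∧ R t ≤ ‖v‖) (hRmono : StrictMonoOn R (Icc (-2) 0))
    (hS0 : ∀ t, t ≤ -1 / 5 → S t = 0) (hS1 : ∀ t, 1 / 5 ≤ t → S t = 1) (hS01 : ∀ t, 0 ≤ S t ∧ S t ≤ 1)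
    (hb : b = fun p => (793 + 95 * p) / 500) (hN : N = 110 * ((k : ℝ) + 1))
    (he : ∀ m, e m = (((‖v‖ : ℝ) : ℂ) + (m : ℂ) * Complex.I) * (((Real.sqrt (‖v‖ ^ 2 + m ^ 2))⁻¹ : ℝ) : ℂ))
    (hfr : fr = fun t p => R t + b p * Real.sin (Real.pi * S t)) (hfm : fm = fun t p => -(b p) * Real.cos (Real.pi * S t))
    (hz : ∀ p, zC (h p) = Complex.mk 0 (-(20 * (k : ℝ))) +
      ((fr (p 0) (p 1) * Real.sqrt (1 - ((p 2) ^ 2 + (p 3) ^ 2) / N ^ 2) : ℝ) : ℂ) * (v / ((‖v‖ : ℝ) : ℂ)) * e (fm (p 0) (p 1)))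
    (hw : ∀ p, wC (h p) = ((fr (p 0) (p 1) / N : ℝ) : ℂ) * ((p 2 : ℂ) + (p 3 : ℂ) * Complex.I))
    (hWdef : W = {p : EuclideanSpace ℝ (Fin 4) | |p 0| < 101 / 100 ∧ |p 1| < 101 / 100 ∧ (p 2) ^ 2 + (p 3) ^ 2 < 6 / 5})
    (hcont : ContinuousOn h W) (hopen : ∀ p ∈ W, ∀ s ∈ 𝓝 p, h '' s ∈ 𝓝 (h p))
    (y : EuclideanSpace ℝ (Fin 4)) (q v' : ℂ) (hq : q = zC y - Complex.mk 0 (-(20 * (k : ℝ))))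
    (hv' : v' = holeCentre k j - Complex.mk 0 (-(20 * (k : ℝ))))
    (hy : ‖wC y‖ ≤ 1 / (2000 * ((k : ℝ) + 1)) ∧
      ((8 / 5 ≤ ‖q - v'‖ ∧ ‖q - v'‖ ≤ 41 / 25 ∧ -(7 / 10) * ‖v'‖ ≤ ((q - v') * conj v').re) ∨
        (2 / 15 ≤ ‖q‖ ∧ ‖q‖ ≤ ‖v'‖ + 1 / 2 ∧ 0 < (q * conj v').re ∧ 8 / 5 * ‖q‖ ≤ |(q * conj v').im| ∧
          |(q * conj v').im| ≤ 41 / 25 * ‖q‖))) :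
    ∃ p ∈ {p : EuclideanSpace ℝ (Fin 4) | |p 0| ≤ 1 ∧ (p 1) ^ 2 + (p 2) ^ 2 + (p 3) ^ 2 ≤ 1}, h p = y := by
  obtain ⟨-, -, hk, -, -, h20, -, hv0, hVpos⟩ := holeDir_props j hv
  rw [hv', ← hv] at hy
  clear hv' v'
  subst hq
  set z₀ : ℂ := Complex.mk 0 (-(20 * (k : ℝ))) with hz₀
  set u : ℂ := v / ((‖v‖ : ℝ) : ℂ) with hu
  have hVc : ((‖v‖ : ℝ) : ℂ) ≠ 0 := by exact_mod_cast hVpos.ne'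
  have hu1 : ‖u‖ = 1 := by
    rw [hu, norm_div, Complex.norm_real, Real.norm_eq_abs, abs_of_pos hVpos, div_self hVpos.ne']
  have hvu : v = ((‖v‖ : ℝ) : ℂ) * u := by rw [hu]; field_simp
  -- the arch as an image of (frame arch) × (disc)
  set P : Set ℂ := {p : ℂ | (8 / 5 ≤ ‖p - ‖v‖‖ ∧ ‖p - ‖v‖‖ ≤ 41 / 25 ∧ -(7 / 10) ≤ p.re - ‖v‖) ∨
    (2 / 15 ≤ ‖p‖ ∧ ‖p‖ ≤ ‖v‖ + 1 / 2 ∧ 0 < p.re ∧ 8 / 5 * ‖p‖ ≤ |‖v‖ * p.im| ∧ |‖v‖ * p.im| ≤ 41 / 25 * ‖p‖)} with hP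
  set B : Set ℂ := closedBall 0 (1 / (2000 * ((k : ℝ) + 1))) with hB
  set Φ : ℂ × ℂ → EuclideanSpace ℝ (Fin 4) := fun pw => ofZW (z₀ + pw.1 * u) pw.2 with hΦ
  set A : Set (EuclideanSpace ℝ (Fin 4)) := Φ '' (P ×ˢ B) with hA
  have hΦz : ∀ f w, zC (Φ (f, w)) = z₀ + f * u := fun f w => zC_ofZW _ _
  have hΦw : ∀ f w, wC (Φ (f, w)) = w := fun f w => wC_ofZW _ _
  -- `y ∈ A`
  have hyA : y ∈ A := by
    obtain ⟨hwy, hqy⟩ := hy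
    rw [hvu] at hqy
    obtain ⟨hfP, hqf⟩ := frame_of_arch hVpos hu1 hqy
    refine ⟨((zC y - z₀) * conj u, wC y), ⟨hfP, by simpa [hB] using hwy⟩, ?_⟩
    show ofZW (z₀ + (zC y - z₀) * conj u * u) (wC y) = y
    rw [← hqf, add_sub_cancel, ofZW_zC_wC]
  -- the parameter boxes
  set K : Set (EuclideanSpace ℝ (Fin 4)) := {p | |p 0| ≤ 201 / 200 ∧ |p 1| ≤ 9 / 10 ∧ (p 2) ^ 2 + (p 3) ^ 2 ≤ 1} with hK
  set U : Set (EuclideanSpace ℝ (Fin 4)) := {p | |p 0| < 201 / 200 ∧ |p 1| < 9 / 10 ∧ (p 2) ^ 2 + (p 3) ^ 2 < 1} with hU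
  obtain ⟨hKc, hUo⟩ := coverBox_props
  have hKW : K ⊆ W := fun p hp => by rw [hWdef]; exact ⟨by linarith [hp.1], by linarith [hp.2.1], by linarith [hp.2.2]⟩
  have hUK : U ⊆ K := fun p hp => ⟨hp.1.le, hp.2.1.le, hp.2.2.le⟩
  -- a parameter of `W` mapped into `A` is well inside
  have key : ∀ p ∈ W, h p ∈ A → |p 0| ≤ 1 ∧ p 1 ≠ 9 / 10 ∧ p 1 ≠ -(9 / 10) ∧ (p 2) ^ 2 + (p 3) ^ 2 ≤ 9 / 50 := by
    rintro p hpW ⟨⟨f, w⟩, ⟨hfP, hwB⟩, hpw⟩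
    have hzf : zC (h p) = z₀ + f * u := by rw [← hpw]; exact hΦz f w
    have hwf : wC (h p) = w := by rw [← hpw]; exact hΦw f w
    obtain ⟨-, hp0, h91, h91', hw23⟩ :=
      chart_arch_avoid hv hReven hRout hRbend hRbounds hRmono hS0 hS1 hS01 hb hN he hfr hfm hz hw hWdef hpW hzf hfP
    exact ⟨hp0, h91, h91', hw23 (by rw [hwf]; simpa [hB] using hwB)⟩
  have havoid : ∀ p ∈ K, h p ∈ A → p ∈ U := by
    intro p hpK hpA
    obtain ⟨hp0, h91, h91', hw23⟩ := key p (hKW hpK) hpA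
    refine ⟨by linarith, lt_of_le_of_ne hpK.2.1 fun habs => ?_, by linarith⟩
    rcases le_or_gt 0 (p 1) with h0 | h0
    · rw [abs_of_nonneg h0] at habs; exact h91 habs
    · rw [abs_of_neg h0] at habs; exact h91' (by linarith)
  -- the base point
  obtain ⟨hbW, hbw, f₀, hzf₀, c1, c2, c3⟩ :=
    chart_base_point hv hReven hSsymm hRout hRbend hRbounds hRmono hS0 hS1 hS01 hb hN he hfr hfm hz hw hWdef
  have hbU : (!₂[0, 3 / 20, 0, 0] : EuclideanSpace ℝ (Fin 4)) ∈ U := by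
    have hi0 : (!₂[0, 3 / 20, 0, 0] : EuclideanSpace ℝ (Fin 4)) 0 = 0 := by simp
    have hi1 : (!₂[0, 3 / 20, 0, 0] : EuclideanSpace ℝ (Fin 4)) 1 = 3 / 20 := by simp
    have hi2 : (!₂[0, 3 / 20, 0, 0] : EuclideanSpace ℝ (Fin 4)) 2 = 0 := by simp
    have hi3 : (!₂[0, 3 / 20, 0, 0] : EuclideanSpace ℝ (Fin 4)) 3 = 0 := by simp
    show |(!₂[0, 3 / 20, 0, 0] : EuclideanSpace ℝ (Fin 4)) 0| < 201 / 200 ∧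
      |(!₂[0, 3 / 20, 0, 0] : EuclideanSpace ℝ (Fin 4)) 1| < 9 / 10 ∧
      ((!₂[0, 3 / 20, 0, 0] : EuclideanSpace ℝ (Fin 4)) 2) ^ 2 + ((!₂[0, 3 / 20, 0, 0] : EuclideanSpace ℝ (Fin 4)) 3) ^ 2 < 1
    rw [hi0, hi1, hi2, hi3]; norm_num
  have hbA : h !₂[0, 3 / 20, 0, 0] ∈ A := by
    refine ⟨(f₀, 0), ⟨Or.inl ⟨c1, c2, c3⟩, ?_⟩, ?_⟩
    · show (0 : ℂ) ∈ closedBall (0 : ℂ) (1 / (2000 * ((k : ℝ) + 1))); exact mem_closedBall_self (by positivity)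
    · show ofZW (z₀ + f₀ * u) 0 = h !₂[0, 3 / 20, 0, 0]
      rw [← hzf₀, ← hbw, ofZW_zC_wC]
  have hne : (A ∩ h '' U).Nonempty := ⟨_, hbA, _, hbU, rfl⟩
  -- `A` is preconnected
  have hAconn : IsPreconnected A := by
    have hPc : IsPathConnected P := isPathConnected_archFrame h20
    have hBc : IsPathConnected B := (convex_closedBall _ _).isPathConnected ⟨0, mem_closedBall_self (by positivity)⟩
    have hΦc : Continuous Φ :=
      continuous_ofZW.comp ((continuous_const.add (continuous_fst.mul continuous_const)).prodMk continuous_snd)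
    exact ((hPc.prod hBc).image hΦc).isConnected.isPreconnected
  -- continuation
  have hsub := subset_image_of_open_at hKc (hcont.mono hKW) hUK hUo
    (fun p hp s hs => hopen p (hKW (hUK hp)) s hs) hAconn havoid hne
  obtain ⟨p, hpK, hpy⟩ := hsub hyA
  obtain ⟨hp0, -, -, hw23⟩ := key p (hKW hpK) (by rw [hpy]; exact hyA)
  refine ⟨p, ⟨hp0, ?_⟩, hpy⟩
  have : (p 1) ^ 2 ≤ (9 / 10) ^ 2 := by
    have h1 := pow_le_pow_left₀ (abs_nonneg _) hpK.2.1 2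
    rwa [sq_abs] at h1
  linarith

end ModelHandles

/-- **Registered piece `helper_handlebodyChart_modelHandles_chartCover` of the data stub, part 1 (the cover of the arch by
one chart)**: the compact parameter box of the continuation argument and its open interior
(`ModelHandles.coverBox_props`); the cover itself is `ModelHandles.chart_cover`. [folklore] -/
theorem helper_handlebodyChart_modelHandles_chartCover : IsCompact {p : EuclideanSpace ℝ (Fin 4) | |p 0| ≤ 201 / 200 ∧ |p 1| ≤ 9 / 10 ∧ (p 2) ^ 2 + (p 3) ^ 2 ≤ 1} ∧ IsOpen {p : EuclideanSpace ℝ (Fin 4) | |p 0| < 201 / 200 ∧ |p 1| < 9 / 10 ∧ (p 2) ^ 2 + (p 3) ^ 2 < 1} :=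
  ModelHandles.coverBox_props

end Summit.SmoothPoincare4.SmoothPoincare4.Theorems.DcrGap.MkFriends

end
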